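import Literature.AnabelianGeometry.AbsoluteAnabelian.AbsTopITemperedCuspsFactRows
import Literature.AnabelianGeometry.SemiGraphs.TemperedCurveGaloisCountableWitness
import Literature.AnabelianGeometry.SemiGraphs.TemperedOriginGenuineNonVacuity
import HarnessLib

/-!
# [AbsTopI] Prop 4.10 (ii) — the cone node's closing theorem RE-CLOSED against the surviving instance
# forms of F-0256 `prop410_i_ii_pointer` (zero FACT binders at non-degenerate carriers)

S. Mochizuki, *Topics in Absolute Anabelian Geometry I: Generalities*, J. Math. Sci. Univ. Tokyo 19
(2012) [MochizukiAbsTopI2012], Prop 4.10 (i), (ii), manuscript p. 60 (lit key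
`paper:url-11ac98ba15fc`):

  "(i) The natural homomorphism `Π^{tp}_X → Π̂^{tp}_X` [...] is injective [...].
   (ii) `Π^{tp}_X` is normally terminal in `Π̂^{tp}_X`."

(printed proof of (ii): "[SemiAnbd] Lemma 6.1 (iii)", i.e. "`N_{Π_{X_K}}(Π^temp_{X_K}) = Π^temp_{X_K}`",
[André] Cor. 6.2.2 / Lem. 3.2.1 via the structure of free groups in their profinite completions).

PROOF-ONLY companion (no definition, no instance, no notation, no named fact; abc-iut cell, seat
abc-iut-w5-d205 gen 14, L4-lead m143 row «K4 RE-CLOSE AbsTopI:Prop4.10(ii)») for the kernel DAG node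
`AbsTopI:Prop4.10(ii)` (`Summits/ABC/IUTFork/DAGXc.lean`, `N_AbsTopI_Prop4_10_ii` = the statement of
`prop410_i_ii_pointer.piTempNormallyTerminal`).  That closing theorem takes the FACT-LIST row **F-0256**
(`prop410_i_ii_pointer X`, class "universal-closure REFUTED / schema": `not_forall_prop410_i_ii_pointer`,
abc-iut-f-092) AS ITS BINDER `h` and returns its second conjunct, the typed (ii)
`X.PiTempNormallyTerminal` (≡ FACT-LIST F-1678, `prop410_i_ii_pointer_iff`).  Before this file the row was
INHABITED AT THE DEGENERATE inhabitant only (`prop410_i_ii_pointer_degenerate`: `Π^temp := G_{ℚ_p} =: Π̂`,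
`toHat = id`, where normal terminality is the triviality `N_Π(Π) = Π`).  This file RE-CLOSES the node
against the SURVIVING INSTANCE FORMS, i.e. it derives the binder — hence the closer's conclusion — with
ZERO assumption-class fact binders:

* §1 CLOSED PRODUCERS of F-0256 binding only print's structural inputs (hypotheses on data, not FACT
  rows): `prop410_i_ii_pointer_of_tower` — `IsTempered Π^temp_{X_K}` ("a tempered topological group",
  [SemiAnbd] p. 69) + the André tower input `htower₀` (cofinal open normal `N` with `Π^temp/N ⊇` a
  non-abelian free normal subgroup of finite index and finite rank) ⇒ `prop410_i_ii_pointer X`, through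
  abc-iut-w5-d240's closer `TemperedCurve.piTempNormallyTerminal_of_tower` (which rests on the tree's
  PROOF of [SemiAnbd] Lem. 6.1 (i), FACT-LIST F-1665 `proved`); `prop410_i_ii_pointer_of_surjective` /
  `prop410_i_ii_pointer_of_compactSpace` — the compact regime (`Π^temp → Π̂` onto), where (ii) is
  content-free; `prop410_i_ii_pointer.piTempNormallyTerminal_eq` — the node's closer IS the projection.
* §2 ZERO-BINDER INSTANCES at the two non-degenerate carriers of record of abc-iut-L3's interface
  `TemperedCurve p`:
  - `exists_temperedCurve_freeRankTwo_prop410_i_ii_pointer` — the NON-COMPACT datum `K = ℚ_p`,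
    `Π^temp := F₂ × G_{ℚ_p}` (`F₂` discrete free of rank two), `Π := F̂₂ × G_{ℚ_p}`, `toHat = η × id`
    (abc-iut-w5-d240 / abc-iut-L3-t6, `TemperedCurveGaloisCountableWitness`): here `Π^temp → Π` is NOT
    onto (`F₂` is countably infinite, `F̂₂` compact Hausdorff — Baire), so "`N_Π(Π^temp) = Π^temp`" has
    content, and it HOLDS with no hypothesis: F-0256 and the node's conclusion at a carrier where the
    refuted universal closure is genuinely at stake;
  - `exists_temperedCurve_compactGenuine_prop410_i_ii_pointer` — abc-iut-w5-d040's COMPACT datum with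
    genuine arithmetic quotient `G_{ℚ_p}`, NONABELIAN slim `Δ^temp ≅ F̂₂` and a CUSP
    (`exists_temperedCurve_groupLevelData_genuine`), where `toHat` is onto and (ii) holds trivially;
  - `exists_temperedCurve_deltaChain_prop410_i_ii_pointer` — the row jointly with the whole §6
    `Δ`-chain of abc-iut-L3-t6 (`aug` open, `Ker(Π → G_K) = Δ`, Lem. 6.1 (ii), Lem. 6.3 (iii) both cases).
* §3 `prop410_i_ii_pointer_independent_nonSurjective` — HONEST STATUS among NON-degenerate inhabitants
  (those with `Π^temp → Π` not onto): the row HOLDS at the free rank-two datum and FAILS at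
  abc-iut-w6-d028's rank-one abelian datum `ℤ × G_{ℚ_p}` (`exists_temperedCurve_rankOne_failures`) — so
  F-0256 stays consumable at NAMED instances only, exactly as the FACT-policy ruling says; nothing here
  moves the row's label.

HONEST FRAMING.  "Re-closed" = OUR kernel theorems with no assumption-class binder, at carriers the tree
constructs; `F₂ × G_{ℚ_p}` and `G_{ℚ_p} × F̂₂` are MODELS of the interface, not André's `π₁^{tp}` of a
hyperbolic orbicurve (which no seat has constructed); the genuine-curve case of (ii) is
`prop410_i_ii_pointer_of_tower`, i.e. PROVED MODULO print's own structural inputs `IsTempered` + tower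
(no FACT row).  [AbsTopI] is a refereed, undisputed paper; nothing here bears on [IUTchIII] Cor. 3.12 or
takes a side on any author; typed ≠ proved elsewhere; re-closed ≠ endorsed.
-/

noncomputable section

namespace Literature.AnabelianGeometry.AbsoluteAnabelian

open Literature.AnabelianGeometry.SemiGraphs
open CategoryTheory ProfiniteGrp ProfiniteGrp.ProfiniteCompletion
open _root_.Topology

/-! ## §1 Closed producers of F-0256 (structural hypotheses only) and the node's closer -/

section Producers

variable {p : ℕ} [Fact p.Prime]

/-- The node's closer `prop410_i_ii_pointer.piTempNormallyTerminal` IS the second projection of its F-0256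
binder (definitional; recorded for the K4 re-close bookkeeping: the binder is ≡ F-1678 by
`prop410_i_ii_pointer_iff`). [cite: MochizukiAbsTopI2012, Prop 4.10 (ii) p.60] -/
theorem prop410_i_ii_pointer.piTempNormallyTerminal_eq {X : TemperedCurve p}
    (h : prop410_i_ii_pointer X) : h.piTempNormallyTerminal = h.2 := rfl

/-- **F-0256 from print's structural inputs, ZERO fact binders** (generic CLOSED producer): for a datum
`X` of abc-iut-L3's interface whose `Π^temp_{X_K}` is a tempered topological group ([SemiAnbd] p. 69,
`IsTempered`) admitting the André tower (cofinally many open normal `N` with `Π^temp/N ⊇` a non-abelian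
free normal subgroup of finite index and finite rank), Prop 4.10 (i) ∧ (ii) holds: (i) is the interface
field `toHat_injective`, (ii) is abc-iut-w5-d240's `TemperedCurve.piTempNormallyTerminal_of_tower`
([SemiAnbd] Lem. 6.1 (iii) from the tree's proof of Lem. 6.1 (i)).
[cite: MochizukiAbsTopI2012, Prop 4.10 (ii) p.60] -/
theorem prop410_i_ii_pointer_of_tower (X : TemperedCurve p) (hT : IsTempered X.PiTemp)
    (htower₀ : ∀ U ∈ 𝓝 (1 : X.PiTemp), ∃ N : OpenNormalSubgroup X.PiTemp, (N : Set X.PiTemp) ⊆ U ∧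
      ∃ (G : Subgroup (X.PiTemp ⧸ N.toSubgroup)) (_ : IsFreeGroup G), G.Normal ∧ G.FiniteIndex ∧
        Finite (IsFreeGroup.Generators G) ∧ ∃ a ∈ G, ∃ b ∈ G, a * b ≠ b * a) :
    prop410_i_ii_pointer X :=
  prop410_i_ii_pointer_of_piTempNormallyTerminal X (X.piTempNormallyTerminal_of_tower hT htower₀)

/-- **F-0256 in the surjective regime** (CLOSED producer): if `Π^temp_{X_K} → Π_{X_K}` is onto, the image
is all of `Π_{X_K}`, whose normaliser is itself — (ii) holds, content-free.
[cite: MochizukiAbsTopI2012, Prop 4.10 (ii) p.60] -/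
theorem prop410_i_ii_pointer_of_surjective (X : TemperedCurve p) (hs : Function.Surjective X.toHat) :
    prop410_i_ii_pointer X := by
  refine prop410_i_ii_pointer_of_piTempNormallyTerminal X ?_
  have hr : X.toHat.toMonoidHom.range = ⊤ := MonoidHom.range_eq_top.mpr hs
  unfold TemperedCurve.PiTempNormallyTerminal
  rw [hr]
  exact Subgroup.normalizer_eq_top (H := (⊤ : Subgroup X.PiHat))

/-- **F-0256 in the compact regime** (CLOSED producer): for compact `Π^temp_{X_K}` the map to the
profinite completion is onto (abc-iut-w6-d055's `toHat_surjective_of_compactSpace`), so (i) ∧ (ii) holds.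
[cite: MochizukiAbsTopI2012, Prop 4.10 (ii) p.60] -/
theorem prop410_i_ii_pointer_of_compactSpace (X : TemperedCurve p) [CompactSpace X.PiTemp] :
    prop410_i_ii_pointer X :=
  prop410_i_ii_pointer_of_surjective X X.toHat_surjective_of_compactSpace

end Producers

/-! ## §2 Zero-binder instances at the non-degenerate carriers of record -/

section Carriers

variable (p : ℕ) [Fact p.Prime]

/-- **F-0256 RE-CLOSED at the non-compact free carrier.**  There is `X : TemperedCurve p` — `K = ℚ_p`,
`Π^temp := F₂ × G_{ℚ_p}` with `F₂` DISCRETE free of rank two, augmentation the second projection,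
`Π := F̂₂ × G_{ℚ_p}`, `toHat = η × id` (`η : F₂ → F̂₂` Mathlib's profinite completion), no closed points
(abc-iut-w5-d240's datum) — at which: `Π^temp` is tempered and NOT compact; `Π^temp → Π` is NOT onto, i.e.
the image is a PROPER subgroup (so normal terminality is not the triviality `N_Π(Π) = Π`); and — with NO
hypothesis — Prop 4.10 (i) ∧ (ii) (`prop410_i_ii_pointer X`, F-0256) holds, whence the node's closing
theorem yields (ii) `N_{Π}(Π^temp) = Π^temp` (`X.PiTempNormallyTerminal`, F-1678) with its binder
DISCHARGED. [cite: MochizukiAbsTopI2012, Prop 4.10 (ii) p.60] -/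
theorem exists_temperedCurve_freeRankTwo_prop410_i_ii_pointer :
    ∃ X : TemperedCurve p, IsTempered X.PiTemp ∧ ¬ CompactSpace X.PiTemp ∧
      ¬ Function.Surjective X.toHat ∧ X.toHat.toMonoidHom.range ≠ ⊤ ∧
      prop410_i_ii_pointer X ∧ X.PiTempNormallyTerminal := by
  -- the datum: adapted verbatim from abc-iut-w5-d240 / abc-iut-L3-t6
  -- (`TemperedAnabelianTowerWitnessCurve`, `TemperedCurveGaloisCountableWitness`)
  letI : TopologicalSpace (FreeGroup (Fin 2)) := ⊥
  haveI : DiscreteTopology (FreeGroup (Fin 2)) := ⟨rfl⟩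
  haveI : IsTopologicalGroup (FreeGroup (Fin 2)) := ⟨⟩
  haveI : IsGalois ℚ_[p] (AlgebraicClosure ℚ_[p]) := {}
  haveI : T2Space (GQp p) := krullTopology_t2
  haveI : Finite (IsFreeGroup.Generators (FreeGroup (Fin 2))) :=
    Finite.of_equiv (Fin 2) (Equiv.ofFreeGroupEquiv (IsFreeGroup.toFreeGroup (FreeGroup (Fin 2))))
  haveI : Infinite (FreeGroup (Fin 2)) := inferInstance
  let η : FreeGroup (Fin 2) →ₜ* completion (GrpCat.of (FreeGroup (Fin 2))) :=
    { toMonoidHom := toProfiniteCompletion (FreeGroup (Fin 2))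
      continuous_toFun := continuous_of_discreteTopology }
  have hη : IsProfiniteCompletion η := isProfiniteCompletion_toProfiniteCompletion (FreeGroup (Fin 2))
  haveI := Literature.GroupTheory.CombinatorialGroupTheory.freeGroup_residuallyFinite (Fin 2)
  have hηinj : Function.Injective η := toProfiniteCompletion_injective
  haveI : CompactSpace (completion (GrpCat.of (FreeGroup (Fin 2)))) := hη.compactSpace
  let X : TemperedCurve p :=
    { K := ⊥
      finiteDimensional_K := inferInstance
      PiTemp := FreeGroup (Fin 2) × GQp p
      aug := ContinuousMonoidHom.snd (FreeGroup (Fin 2)) (GQp p)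
      range_aug := by
        rw [IntermediateField.fixingSubgroup_bot]
        exact MonoidHom.range_eq_top.mpr Prod.snd_surjective
      PiHat := completion (GrpCat.of (FreeGroup (Fin 2))) × GQp p
      toHat := η.prodMap (ContinuousMonoidHom.id (GQp p))
      isProfiniteCompletion_toHat := hη.prodMap_id
      toHat_injective := hηinj.prodMap Function.injective_id
      augHat := ContinuousMonoidHom.snd _ (GQp p)
      augHat_comp := fun _ => rfl
      Pt := PEmpty
      IsCusp := fun x => x.elim
      decomp := fun x => x.elim
      isClosed_decomp := fun x => x.elim
      isOpen_aug_decomp := fun x => x.elim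
      inertia_eq_bot := fun x => x.elim
      inertia_equiv_zHat := fun x => x.elim }
  -- (T) tempered and (VF₀) the tower, for the product with the profinite group `G_{ℚ_p}`
  have hT : IsTempered X.PiTemp := isTempered_of_discreteTopology.prod_of_profinite
  have hab : FreeGroup.of (0 : Fin 2) * FreeGroup.of 1 ≠ FreeGroup.of 1 * FreeGroup.of 0 := by
    intro h
    let f : FreeGroup (Fin 2) →* Equiv.Perm (Fin 3) :=
      FreeGroup.lift ![Equiv.swap 0 1, Equiv.swap 1 2]
    have h2 := congrArg f h
    simp only [map_mul, f, FreeGroup.lift_apply_of] at h2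
    exact absurd h2 (by decide)
  have htower := tower_prod_of_profinite (Γ := GQp p)
    (tower_of_isFreeGroup (F := FreeGroup (Fin 2)) ⟨FreeGroup.of 0, FreeGroup.of 1, hab⟩)
  -- not compact: the first projection `F₂` would be a compact discrete, hence finite, group
  have hnc : ¬ CompactSpace X.PiTemp := by
    intro hc
    have hcomp : IsCompact (Set.univ : Set (FreeGroup (Fin 2))) := by
      have h := (isCompact_univ (X := FreeGroup (Fin 2) × GQp p)).image continuous_fst
      rwa [Set.image_univ, Set.range_eq_univ.mpr Prod.fst_surjective] at h
    haveI : CompactSpace (FreeGroup (Fin 2)) := ⟨hcomp⟩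
    haveI : Finite (FreeGroup (Fin 2)) := finite_of_compact_of_discrete
    exact not_finite (FreeGroup (Fin 2))
  -- `toHat = η × id` is not onto, since `η : F₂ → F̂₂` is not (countable infinite into compact Hausdorff)
  have hηns : ¬ Function.Surjective η := not_surjective_of_injective_of_compactSpace η hηinj
  have hns : ¬ Function.Surjective X.toHat := by
    intro hs
    apply hηns
    intro z
    obtain ⟨⟨n, g⟩, hng⟩ := hs (z, 1)
    exact ⟨n, (Prod.mk.inj hng).1⟩
  have hrange : X.toHat.toMonoidHom.range ≠ ⊤ := fun h => hns (MonoidHom.range_eq_top.1 h)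
  have h410 : prop410_i_ii_pointer X := prop410_i_ii_pointer_of_tower X hT htower
  exact ⟨X, hT, hnc, hns, hrange, h410, h410.piTempNormallyTerminal⟩

/-- **F-0256 RE-CLOSED at the compact genuine carrier.**  At abc-iut-w5-d040's §6 datum with GENUINE
arithmetic quotient (`K = ℚ_p`, `aug` onto `G_{ℚ_p}`), NONABELIAN geometric part `Δ^temp ≅ F̂₂`, a CUSP and
compact `Π^temp := G_{ℚ_p} × F̂₂` (`exists_temperedCurve_groupLevelData_genuine`), `Π^temp → Π` is onto and
Prop 4.10 (i) ∧ (ii) holds with NO hypothesis (compact regime; (ii) is content-free there).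
[cite: MochizukiAbsTopI2012, Prop 4.10 (ii) p.60] -/
theorem exists_temperedCurve_compactGenuine_prop410_i_ii_pointer :
    ∃ X : TemperedCurve p, Function.Surjective X.aug ∧ (∃ x : X.Pt, X.IsCusp x) ∧
      (∃ g ∈ X.DeltaTemp, ∃ h ∈ X.DeltaTemp, g * h ≠ h * g) ∧ CompactSpace X.PiTemp ∧
      Function.Surjective X.toHat ∧ prop410_i_ii_pointer X ∧ X.PiTempNormallyTerminal := by
  obtain ⟨X, -, haug, -, hcusp, hnonab, -, -, hc, -⟩ := exists_temperedCurve_groupLevelData_genuine p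
  haveI := hc
  have h410 : prop410_i_ii_pointer X := prop410_i_ii_pointer_of_compactSpace X
  exact ⟨X, haug, hcusp, hnonab, hc, X.toHat_surjective_of_compactSpace, h410, h410.piTempNormallyTerminal⟩

/-- **F-0256 jointly with the [SemiAnbd] §6 `Δ`-chain** at abc-iut-L3-t6's non-compact datum
(`exists_temperedCurve_deltaChain`): the augmentation is an open map, `Ker(Π_X → G_K) = Δ_X`,
`Δ^temp_X ↪ Δ_X` is a profinite completion, Lem. 6.1 (ii) `N_{Δ_X}(Δ^temp_X) = Δ^temp_X`, and Prop 4.10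
(i) ∧ (ii) — all with no hypothesis. [cite: MochizukiAbsTopI2012, Prop 4.10 (ii) p.60] -/
theorem exists_temperedCurve_deltaChain_prop410_i_ii_pointer :
    ∃ X : TemperedCurve p, ¬ CompactSpace X.PiTemp ∧ IsOpenMap X.aug ∧
      X.augHat.toMonoidHom.ker = X.DeltaHat ∧ IsProfiniteCompletion X.deltaToHat ∧
      X.DeltaTempNormallyTerminal ∧ prop410_i_ii_pointer X := by
  obtain ⟨X, hnc, hopen, hker, hcompl, h61ii, h61iii, -, -⟩ := exists_temperedCurve_deltaChain p
  exact ⟨X, hnc, hopen, hker, hcompl, h61ii, prop410_i_ii_pointer_of_piTempNormallyTerminal X h61iii⟩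

/-! ## §3 Honest status of F-0256 among the non-degenerate inhabitants -/

/-- **F-0256 takes BOTH truth values among the NON-degenerate inhabitants of the interface** (those
whose `Π^temp → Π` is not onto): it HOLDS at the free rank-two datum `F₂ × G_{ℚ_p}`
(`exists_temperedCurve_freeRankTwo_prop410_i_ii_pointer`) and FAILS at abc-iut-w6-d028's rank-one abelian
datum `ℤ × G_{ℚ_p}` (`exists_temperedCurve_rankOne_failures`: the image of `Π^temp` is a proper NORMAL
subgroup of `Π`).  The row is a schema consumable at NAMED instances; this file supplies the instances, it
does not move the label. [cite: MochizukiAbsTopI2012, Prop 4.10 (ii) p.60] -/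
theorem prop410_i_ii_pointer_independent_nonSurjective :
    (∃ X : TemperedCurve p, ¬ Function.Surjective X.toHat ∧ prop410_i_ii_pointer X) ∧
      ∃ X : TemperedCurve p, ¬ Function.Surjective X.toHat ∧ ¬ prop410_i_ii_pointer X := by
  refine ⟨?_, ?_⟩
  · obtain ⟨X, -, -, hns, -, h410, -⟩ := exists_temperedCurve_freeRankTwo_prop410_i_ii_pointer p
    exact ⟨X, hns, h410⟩
  · obtain ⟨X, -, -, hns, -, hNT, -⟩ := exists_temperedCurve_rankOne_failures p
    exact ⟨X, hns, fun h => hNT h.piTempNormallyTerminal⟩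

end Carriers

end Literature.AnabelianGeometry.AbsoluteAnabelian

end
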